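import Mathlib
import HarnessLib

set_option linter.dupNamespace false
set_option autoImplicit false

/-!
# Route `RamifiedSevenEllipticUnits` (rung K7r), Value crux `EllipticUnitValueSeven`
# (stmt-BirchSwinnertonDyer-19705), line `rubin-formula`, stub S_B4 `stub_bottomLocalIndexSplitSeven`:
# the INDEX CALCULUS behind `λ₀ = c + m_loc` (§1 of two; `--supports 19705`; PROVED, nothing asserted,
# no named fact)

Cell `bsd-cm`, seat `bsd-cm-k7r-c4` g5 (BRIEF-k7r-split, planner g18). HONEST FRAMING: nothing here
closes the stub, the crux, the leaf or any item; BSD is not proved. This file is pure algebra (abstract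
additive groups); its sibling `RamifiedSevenEllipticUnitsBottomLocalIndexSplitKummer.lean` is the
plumbing over the tree's compact Selmer currency; the companion file
`RamifiedSevenEllipticUnitsBottomLocalIndexSplit.lean` instantiates both on the carriers of S_B4.

## §1 Abstract index calculus (any additive commutative groups `A`, `B`, `f : A →+ B`)

* `relIndex_split` — **the product lemma** = the algebra of S_B4′: for subgroups
  `Z ≤ M ≤ G ≤ T_A ⊔ M` of `A`, `T_B, L` of `B` with `f(T_A) ≤ T_B`, `f(M) ≤ L` and
  `M ⊓ f⁻¹(T_B) ≤ T_A` ("`f` injective on `M` modulo the `T`'s):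
  `[L : T_B ⊔ f Z] = [G : T_A ⊔ Z] · [L : T_B ⊔ f M]` (relative indices, `AddSubgroup.relIndex`).
  Read with `A = ∏_k H¹(K, E[p^k])`, `B` = its local twin at `𝔭`, `f = loc_𝔭`, `T` = torsion,
  `Z = 𝒪·z(𝟙)`, `M = E(K) ⊗ ℤ_p`, `G = S_{p,rel}(E/K)`, `L = E(K_𝔭) ⊗ ℤ_p`: `p^{λ₀} = p^c · p^{m_loc}`.
* `relIndex_eq_zero_of_countable` — **the vacuity lemma**: if `Y` is countable and `K` contains the
  image of an uncountable torsion-free group under an additive map meeting `T` only at `0`, then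
  `[K : (T ⊔ Y) ⊓ K]` is infinite (`relIndex = 0`). With `uncountable_padicInt` this is the kernel
  form of the carrier audit of the cell memo `MEMO-k7r-c4-g5-CARRIER.md` (evidence #10 on 19705):
  the `End_K(E)`-span `endSpan` is a countable ℤ-lattice, so an index `p^c` against a group containing
  a `ℤ_p`-line is impossible.
* `uncountable_padicInt` — `ℤ_p` is uncountable (Baire), the cardinality input of the vacuity lemma.

References: Silverman, *AEC* VIII.§2 (Kummer sequence), X.§4; Perrin-Riou, Bull. SMF 115 (1987) §0
(`S_p(L)`); Howard, Compositio 140 (2004) §1 (descent sequence); Serre, *Local Fields* VII.§5 /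
*Galois Cohomology* I.§2.5 (conjugation on cohomology); cell memo MEMO-k7r-c4-g5-CARRIER.md.
-/

noncomputable section

open scoped Classical

universe u

namespace Summit.BirchSwinnertonDyer.BirchSwinnertonDyer.Theorems.RamifiedSevenEllipticUnits

namespace BottomLocalIndexSplit

/-! ## §1 Abstract index calculus -/

section Abstract

open AddSubgroup

variable {A B : Type*} [AddCommGroup A] [AddCommGroup B]

/-- `[K : H ⊓ K] = [K ⊔ H : H]` (second isomorphism theorem as an index identity; Mathlib's
`relIndex_sup_right` read backwards). [cite: Miller2011LMS, Def. 1.1 (arXiv:1010.2431 p. 3) (index bookkeeping; folklore algebra)] -/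
theorem relIndex_eq_relIndex_sup (H K : AddSubgroup A) : H.relIndex K = H.relIndex (K ⊔ H) :=
  (relIndex_sup_right K H).symm

/-- If `K ≤ H ⊔ (K ⊓ L)` then `[K ⊓ L : H ⊓ K ⊓ L] = [K : H ⊓ K]` (both equal `[K ⊔ H : H]`).
[cite: Miller2011LMS, Def. 1.1 (arXiv:1010.2431 p. 3) (index bookkeeping; folklore algebra)] -/
theorem relIndex_inf_eq_of_le_sup (H K L : AddSubgroup A) (hK : K ≤ H ⊔ (K ⊓ L)) :
    H.relIndex (K ⊓ L) = H.relIndex K := by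
  rw [relIndex_eq_relIndex_sup H (K ⊓ L), relIndex_eq_relIndex_sup H K]
  congr 1
  exact le_antisymm (sup_le (inf_le_left.trans le_sup_left) le_sup_right)
    (sup_le (hK.trans (sup_le le_sup_right le_sup_left)) le_sup_right)

/-- **Transport of a relative index along a homomorphism.** If `Z ≤ M`, `f(T_A) ≤ T_B` and
`(T_A ⊔ M) ⊓ f⁻¹(T_B) ≤ T_A` then `[T_B ⊔ f M : T_B ⊔ f Z] = [T_A ⊔ M : T_A ⊔ Z]`: modulo the `T`'s,
`f` restricted to `M` is injective, so it preserves the index of `Z` in `M`.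
[cite: Miller2011LMS, Def. 1.1 (arXiv:1010.2431 p. 3) (index bookkeeping; folklore algebra)] -/
theorem relIndex_sup_map_eq (f : A →+ B) (TA Z M : AddSubgroup A) (TB : AddSubgroup B)
    (hZM : Z ≤ M) (hT : TA.map f ≤ TB) (hinj : (TA ⊔ M) ⊓ TB.comap f ≤ TA) :
    (TB ⊔ Z.map f).relIndex (TB ⊔ M.map f) = (TA ⊔ Z).relIndex (TA ⊔ M) := by
  have h1 : (TB ⊔ Z.map f).relIndex (TB ⊔ M.map f) =
      (TB ⊔ Z.map f).relIndex ((TA ⊔ M).map f) := by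
    rw [relIndex_eq_relIndex_sup _ (TB ⊔ M.map f), relIndex_eq_relIndex_sup _ ((TA ⊔ M).map f)]
    congr 1
    rw [AddSubgroup.map_sup]
    apply le_antisymm
    · refine sup_le (sup_le ?_ ?_) le_sup_right
      · exact le_sup_left.trans le_sup_right
      · exact le_sup_right.trans le_sup_left
    · refine sup_le (sup_le ?_ ?_) le_sup_right
      · exact hT.trans (le_sup_left.trans le_sup_right)
      · exact le_sup_right.trans le_sup_left
  rw [h1, ← relIndex_comap, ← inf_relIndex_right ((TB ⊔ Z.map f).comap f)]
  have h3 : (TB ⊔ Z.map f).comap f ⊓ (TA ⊔ M) = (TA ⊔ Z) ⊓ (TA ⊔ M) := by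
    apply le_antisymm
    · intro x hx
      have hx1 : f x ∈ TB ⊔ Z.map f := (mem_inf.1 hx).1
      have hxM : x ∈ TA ⊔ M := (mem_inf.1 hx).2
      refine mem_inf.2 ⟨?_, hxM⟩
      obtain ⟨t, ht, w, hw, htw⟩ := mem_sup.1 hx1
      obtain ⟨z, hz, rfl⟩ := mem_map.1 hw
      have hxz : x - z ∈ TA := by
        refine hinj (mem_inf.2 ⟨?_, ?_⟩)
        · exact sub_mem hxM (mem_sup_right (hZM hz))
        · rw [mem_comap, map_sub, ← htw, add_sub_cancel_right]
          exact ht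
      exact mem_sup.2 ⟨x - z, hxz, z, hz, sub_add_cancel x z⟩
    · intro x hx
      have hx1 : x ∈ TA ⊔ Z := (mem_inf.1 hx).1
      have hxM : x ∈ TA ⊔ M := (mem_inf.1 hx).2
      refine mem_inf.2 ⟨?_, hxM⟩
      obtain ⟨t, ht, z, hz, rfl⟩ := mem_sup.1 hx1
      rw [mem_comap, map_add]
      exact add_mem (mem_sup_left (hT ⟨t, ht, rfl⟩)) (mem_sup_right ⟨z, hz, rfl⟩)
  rw [h3, inf_relIndex_right]

/-- **THE PRODUCT LEMMA (the algebra of S_B4′: `λ₀ = c + m_loc`).** For `Z ≤ M ≤ G ≤ T_A ⊔ M` in `A`,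
`T_B, L ≤ B`, `f : A →+ B` with `f(T_A) ≤ T_B`, `f(M) ≤ L` and `M ⊓ f⁻¹(T_B) ≤ T_A`:
`[L : T_B ⊔ f Z] = [G : T_A ⊔ Z] · [L : T_B ⊔ f M]` (relative indices). Chain:
`[L : T_B+fZ] = [L : T_B+fM]·[T_B+fM : T_B+fZ]` (because `fM ≤ L`), `[T_B+fM : T_B+fZ] = [T_A+M : T_A+Z]`
(`relIndex_sup_map_eq`), `[T_A+M : T_A+Z] = [G : T_A+Z]` (because `M ≤ G ≤ T_A+M`).
[cite: PerrinRiou1987BSMF, §0 pp. 401–402 (the descent sequence `0 → E(L) ⊗ ℤ_p → S_p(L) → T_pШ → 0` along which the index splits)] -/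
theorem relIndex_split (f : A →+ B) (TA Z M G : AddSubgroup A) (TB L : AddSubgroup B)
    (hZM : Z ≤ M) (hMG : M ≤ G) (hGM : G ≤ TA ⊔ M) (hT : TA.map f ≤ TB) (hML : M.map f ≤ L)
    (hinj : M ⊓ TB.comap f ≤ TA) :
    (TB ⊔ Z.map f).relIndex L = (TA ⊔ Z).relIndex G * (TB ⊔ M.map f).relIndex L := by
  have hle : TB ⊔ Z.map f ≤ TB ⊔ M.map f := sup_le_sup_left (map_mono hZM) _
  have h0 := relIndex_inf_mul_relIndex (TB ⊔ Z.map f) (TB ⊔ M.map f) L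
  rw [inf_of_le_left hle] at h0
  rw [← h0]
  congr 1
  have hK : TB ⊔ M.map f ≤ (TB ⊔ Z.map f) ⊔ ((TB ⊔ M.map f) ⊓ L) := by
    refine sup_le (le_sup_left.trans le_sup_left) fun x hx ↦ ?_
    exact mem_sup_right (mem_inf.2 ⟨mem_sup_right hx, hML hx⟩)
  rw [relIndex_inf_eq_of_le_sup _ _ _ hK]
  have hinj' : (TA ⊔ M) ⊓ TB.comap f ≤ TA := by
    intro x hx
    have hx1 : x ∈ TA ⊔ M := (mem_inf.1 hx).1
    have hxT : f x ∈ TB := (mem_inf.1 hx).2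
    obtain ⟨t, ht, m, hm, rfl⟩ := mem_sup.1 hx1
    have hmT : m ∈ TA := by
      refine hinj (mem_inf.2 ⟨hm, ?_⟩)
      rw [mem_comap]
      rw [map_add] at hxT
      have := sub_mem hxT (hT ⟨t, ht, rfl⟩)
      rwa [add_sub_cancel_left] at this
    exact add_mem ht hmT
  rw [relIndex_sup_map_eq f TA Z M TB hZM hT hinj']
  rw [relIndex_eq_relIndex_sup _ (TA ⊔ M), relIndex_eq_relIndex_sup _ G]
  congr 1
  apply le_antisymm
  · exact sup_le (sup_le (le_sup_left.trans le_sup_right) (hMG.trans le_sup_left)) le_sup_right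
  · exact sup_le (hGM.trans (sup_le (le_sup_left.trans le_sup_right)
      (le_sup_right.trans le_sup_left))) le_sup_right

/-- **THE VACUITY LEMMA.** If `Y` is countable and `K` contains the image of an uncountable
torsion-free group `C` under an additive map `ℓ` meeting `T` only at `ℓ 0`, then `T ⊔ Y` has infinite
index in `K` (`relIndex = 0`): a finite index `N` would embed `c ↦ N·ℓ(c) mod T` injectively into the
countable group `(T ⊔ Y)/T ≅ Y/(Y ⊓ T)`. The kernel form of the cell's carrier audit (memo
MEMO-k7r-c4-g5-CARRIER.md §2 (d)). [cite: PerrinRiou1987BSMF, §0 p. 401 (`S_p(L)` is a compact `ℤ_p`-module; the `ℤ_p`-lines live there)] -/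
theorem relIndex_eq_zero_of_countable {C : Type*} [AddCommGroup C] [IsAddTorsionFree C]
    [Uncountable C] (T Y K : AddSubgroup A) (hY : (Y : Set A).Countable) (ℓ : C →+ A)
    (hℓK : ∀ c, ℓ c ∈ K) (hinj : ∀ c, ℓ c ∈ T → c = 0) : (T ⊔ Y).relIndex K = 0 := by
  by_contra hN
  have hmem : ∀ c, (T ⊔ Y).relIndex K • ℓ c ∈ T ⊔ Y := fun c ↦ nsmul_relIndex_mem (T ⊔ Y) (hℓK c)
  choose t ht y hy hty using fun c ↦ mem_sup.1 (hmem c)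
  have hinj' : Function.Injective fun c ↦ (⟨y c, hy c⟩ : Y) := by
    intro c c' h
    simp only [Subtype.mk.injEq] at h
    have hT : ℓ ((T ⊔ Y).relIndex K • (c - c')) ∈ T := by
      rw [map_nsmul, map_sub, nsmul_sub, ← hty c, ← hty c', h, add_sub_add_right_eq_sub]
      exact sub_mem (ht c) (ht c')
    have h0 := hinj _ hT
    rw [nsmul_eq_zero_iff_right hN] at h0
    exact sub_eq_zero.1 h0
  haveI : Countable Y := hY.to_subtype
  exact not_countable_iff.2 ‹Uncountable C› hinj'.countable

end Abstract

/-- **`ℤ_p` is uncountable** (Baire: a countable complete metric space has an isolated point, but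
`x + p^n → x` with `p^n ≠ 0`). The cardinality input of the vacuity lemma. [cite: SerreLocalFields1979, II.§1 (the `p`-adic integers as a compact valuation ring; folklore topology)] -/
theorem uncountable_padicInt (p : ℕ) [Fact p.Prime] : Uncountable ℤ_[p] := by
  rw [← not_countable_iff]
  intro hc
  obtain ⟨x, hx⟩ := nonempty_interior_of_iUnion_of_closed (X := ℤ_[p])
    (f := fun x : ℤ_[p] ↦ ({x} : Set ℤ_[p])) (fun _ ↦ isClosed_singleton)
    (Set.eq_univ_of_forall fun y ↦ Set.mem_iUnion.2 ⟨y, Set.mem_singleton y⟩)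
  have hopen : IsOpen ({x} : Set ℤ_[p]) := by
    obtain ⟨y, hy⟩ := hx
    have hyx : y = x := Set.mem_singleton_iff.1 (interior_subset hy)
    subst hyx
    have hint : interior ({y} : Set ℤ_[p]) = {y} :=
      Set.Subset.antisymm interior_subset (Set.singleton_subset_iff.2 hy)
    rw [← hint]
    exact isOpen_interior
  rw [Metric.isOpen_singleton_iff] at hopen
  obtain ⟨ε, hε, hball⟩ := hopen
  have hp : (1 : ℝ) < p := by exact_mod_cast (Fact.out : p.Prime).one_lt
  obtain ⟨n, hn⟩ := exists_pow_lt_of_lt_one hε (inv_lt_one_of_one_lt₀ hp)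
  have h := hball (x + (p : ℤ_[p]) ^ n) (by
    rw [dist_eq_norm, add_sub_cancel_left, norm_pow, PadicInt.norm_p]
    exact hn)
  have h0 : (p : ℤ_[p]) ^ n = 0 := by simpa using h
  exact pow_ne_zero n (by exact_mod_cast (Fact.out : p.Prime).ne_zero) h0

end BottomLocalIndexSplit

end Summit.BirchSwinnertonDyer.BirchSwinnertonDyer.Theorems.RamifiedSevenEllipticUnits

end
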